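import Summits.QuantumFields.YangMills.Theorems.InfiniteVolumeContinuumOnsetFloorsKOfReference
import HarnessLib

/-!
# Leaf `InfiniteVolumeContinuum.HypercubicOSDataFromInfiniteVolume` (stmt-QuantumFields-19868), registered stub
# N `stub_onsetFloorsK : OnsetFloorsK` — part 3: the KERNEL reference package of crux `NT` (one frozen-exterior
# femto cube per coupling; landed `Reference.nt_of_referencePackage`) feeds N as well

Helper file (`--supports stmt-QuantumFields-19868`) of prover seat `ymfull-r2a-prover-1` (R590-ym item 13), stub N of the
skeleton of record `Cruxes/HypercubicOSDataFromInfiniteVolume/Lines/octave_doubling.lean` (REV 2.1).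

Part 2 (`…OnsetFloorsKOfReference.lean`) showed N ⟸ the PERIODIC reference package (= the registered `RefPkgT`), the
frozen-boundary femto package and `NTFemto ∧ stub_fcp6`.  The reference-state series of crux `NT` also carries the
KERNEL reference package (reference state = ONE cube kernel with an arbitrary exterior `ηr β` per coupling; files IV–VI,
X; `Reference.nt_of_referencePackage`), whose floor witnesses again live in `closedBall 0 σ`.  With the landed
explicit-witness forms `Reference.q2_floor_of_reference` / `Reference.q3_floor_of_reference`:

* `lowerBoundsK_of_referencePackage` — the kernel reference package for `(r, a)` ⇒ `LowerBoundsK G r a`;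
* `onsetFloorsK_of_referencePackage` — the hypothesis of `Reference.nt_of_referencePackage` VERBATIM ⇒ `OnsetFloorsK`.

HONEST LABEL: CONDITIONAL reduction (bookkeeping on the NT engine hypotheses, open / XL / unprinted); nothing here proves
non-triviality, the leaf, any crux, rung or summit; finite-volume / conditional content only; the Yang–Mills mass gap
is NOT proved.
-/

set_option autoImplicit false

noncomputable section

open scoped SchwartzMap
open MeasureTheory Filter Topology
open Literature.MathematicalPhysics.QuantumFieldTheory Literature.MathematicalPhysics.QuantumLattice
open Literature.Probability.LatticeModels
open Summit.QuantumFields.YangMills.Cruxes.OSLegsFromFemtoAndGap.DlrCollarTransfer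
open Summit.QuantumFields.YangMills.Cruxes.NT.Reference
open Summit.QuantumFields.YangMills.Cruxes.UVSeamRec.ReferenceFloors (hasCompactSupport_of_tsupport_subset_closedBall)
open Summit.QuantumFields.YangMills.Cruxes.AtomicCalibrationR.MirrorCalibration (LowerBoundsK OnsetFloorsK)

namespace Summit.QuantumFields.YangMills.Cruxes.HypercubicOSDataFromInfiniteVolume.OnsetFloorsN

section Kernel

variable (G : Type) [Group G] [TopologicalSpace G] [IsTopologicalGroup G] [CompactSpace G]
  [MeasurableSpace G] [BorelSpace G] (r : LatticeRep G)

/-- **`LowerBoundsK` from the KERNEL reference package.**  Units (`0 < a`, `a → 0`), constants, reference radius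
`ρ > σ + κ`, reference exteriors `ηr`, (E1/E2/E3-osc) on femto cubes, and the two floors with margin in the cube
kernel of radius `⌈ρ/aβ⌉₊` with exterior `ηr β` for witnesses supported in `closedBall 0 σ` ⇒ the compact-witness
floors `LowerBoundsK G r a` with those witnesses, `Λ₅ = σ + κ + 1` (landed `q2/q3_floor_of_reference`). [folklore] -/
theorem lowerBoundsK_of_referencePackage (a : ℝ → ℝ) (ha₀ : ∀ β, 0 < a β) (ha : Tendsto a atTop (𝓝 0))
    {C₁ C₂ C₃ ℓ ρ σ κ : ℝ} (hC₁ : 0 ≤ C₁) (hC₂ : 0 ≤ C₂) (hC₃ : 0 ≤ C₃) (hσ : 0 < σ) (hκ : 0 < κ)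
    (hℓ : 2 * (σ + κ) < ℓ) (hρ : σ + κ < ρ) (ηr : ℝ → LGConfig 4 G)
    (hE1 : ∃ β₁ : ℝ, ∀ β : ℝ, β₁ ≤ β → ∀ (c : Fin 4 → ℤ) (b : ℕ), (b : ℝ) * a β ≤ ℓ →
      ∀ (η η' : LGConfig 4 G) (x : Fin 4 → ℤ), 1 ≤ depth c b x →
        |kerE G r β c b η (dens G r x) - kerE G r β c b η' (dens G r x)| ≤ C₁ / (depth c b x : ℝ) ^ 4)
    (hE2 : ∃ β₂ : ℝ, ∀ β : ℝ, β₂ ≤ β → ∀ (c : Fin 4 → ℤ) (b : ℕ), (b : ℝ) * a β ≤ ℓ →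
      ∀ (η η' : LGConfig 4 G) (x y : Fin 4 → ℤ), 1 ≤ depth c b x → 1 ≤ depth c b y →
        |kerCov G r β c b η (dens G r x) (dens G r y) - kerCov G r β c b η' (dens G r x) (dens G r y)| ≤
          C₂ / ((min (depth c b x) (depth c b y) : ℕ) : ℝ) ^ 4 / (1 + ‖siteToE (y - x)‖) ^ 4)
    (hE3 : ∃ β₃ : ℝ, ∀ β : ℝ, β₃ ≤ β → ∀ (c : Fin 4 → ℤ) (b : ℕ), (b : ℝ) * a β ≤ ℓ →
      ∀ (η η' : LGConfig 4 G) (x y z : Fin 4 → ℤ), 1 ≤ depth c b x → 1 ≤ depth c b y → 1 ≤ depth c b z →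
        |kerK3 G r β c b η x y z - kerK3 G r β c b η' x y z| ≤
          C₃ / ((min (min (depth c b x) (depth c b y)) (depth c b z) : ℕ) : ℝ) ^ 4 /
            (1 + min (min ‖siteToE (y - x)‖ ‖siteToE (z - y)‖) ‖siteToE (z - x)‖) ^ 8)
    (hR2 : ∃ (v : 𝓢(EuclideanSpace ℝ (Fin 4), ℝ)) (ε β₅ : ℝ),
      tsupport (v : EuclideanSpace ℝ (Fin 4) → ℝ) ⊆ {y | 0 < y 0} ∧
      tsupport (v : EuclideanSpace ℝ (Fin 4) → ℝ) ⊆ Metric.closedBall 0 σ ∧ 0 < ε ∧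
      ∀ β : ℝ, β₅ ≤ β →
        ε + 2 * (C₁ * (a β / κ) ^ 4 * ∑ x ∈ box 4 ⌈ρ / a β⌉₊, |thetaTest 4 v (a β • siteToE x)|) *
              (C₁ * (a β / κ) ^ 4 * ∑ y ∈ box 4 ⌈ρ / a β⌉₊, |v (a β • siteToE y)|) +
            C₂ * (a β / κ) ^ 4 * ∑ x ∈ box 4 ⌈ρ / a β⌉₊, ∑ y ∈ box 4 ⌈ρ / a β⌉₊,
              |thetaTest 4 v (a β • siteToE x)| * |v (a β • siteToE y)| / (1 + ‖siteToE (y - x)‖) ^ 4 ≤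
          ∑ x ∈ box 4 ⌈ρ / a β⌉₊, ∑ y ∈ box 4 ⌈ρ / a β⌉₊,
            thetaTest 4 v (a β • siteToE x) * v (a β • siteToE y) *
              kerCov G r β (fun _ => -(⌈ρ / a β⌉₊ : ℤ)) (2 * ⌈ρ / a β⌉₊ + 1) (ηr β) (dens G r x) (dens G r y))
    (hR3 : ∃ (f g h : 𝓢(EuclideanSpace ℝ (Fin 4), ℝ)) (ε β₅ : ℝ),
      Disjoint (tsupport (f : EuclideanSpace ℝ (Fin 4) → ℝ)) (tsupport (g : EuclideanSpace ℝ (Fin 4) → ℝ)) ∧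
      Disjoint (tsupport (g : EuclideanSpace ℝ (Fin 4) → ℝ)) (tsupport (h : EuclideanSpace ℝ (Fin 4) → ℝ)) ∧
      Disjoint (tsupport (f : EuclideanSpace ℝ (Fin 4) → ℝ)) (tsupport (h : EuclideanSpace ℝ (Fin 4) → ℝ)) ∧
      tsupport (f : EuclideanSpace ℝ (Fin 4) → ℝ) ⊆ Metric.closedBall 0 σ ∧
      tsupport (g : EuclideanSpace ℝ (Fin 4) → ℝ) ⊆ Metric.closedBall 0 σ ∧
      tsupport (h : EuclideanSpace ℝ (Fin 4) → ℝ) ⊆ Metric.closedBall 0 σ ∧ 0 < ε ∧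
      ∀ β : ℝ, β₅ ≤ β →
        ε + ∑ x ∈ box 4 ⌈ρ / a β⌉₊, ∑ y ∈ box 4 ⌈ρ / a β⌉₊, ∑ z ∈ box 4 ⌈ρ / a β⌉₊,
            |f (a β • siteToE x)| * |g (a β • siteToE y)| * |h (a β • siteToE z)| *
              (2 * ((C₁ * (a β / κ) ^ 4) * (C₂ * (a β / κ) ^ 4 / (1 + ‖siteToE (z - y)‖) ^ 4) +
                    (C₁ * (a β / κ) ^ 4) * (C₂ * (a β / κ) ^ 4 / (1 + ‖siteToE (z - x)‖) ^ 4) +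
                    (C₁ * (a β / κ) ^ 4) * (C₂ * (a β / κ) ^ 4 / (1 + ‖siteToE (y - x)‖) ^ 4) +
                    (C₁ * (a β / κ) ^ 4) * (C₁ * (a β / κ) ^ 4) * (C₁ * (a β / κ) ^ 4)) +
                C₃ * (a β / κ) ^ 4 / (1 + min (min ‖siteToE (y - x)‖ ‖siteToE (z - y)‖) ‖siteToE (z - x)‖) ^ 8) ≤
          |∑ x ∈ box 4 ⌈ρ / a β⌉₊, ∑ y ∈ box 4 ⌈ρ / a β⌉₊, ∑ z ∈ box 4 ⌈ρ / a β⌉₊,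
            f (a β • siteToE x) * g (a β • siteToE y) * h (a β • siteToE z) *
              kerK3 G r β (fun _ => -(⌈ρ / a β⌉₊ : ℤ)) (2 * ⌈ρ / a β⌉₊ + 1) (ηr β) x y z|) :
    LowerBoundsK G r a := by
  obtain ⟨v, ε, β₅, hvpos, hvσ, hε, HR⟩ := hR2
  obtain ⟨f, g, h, ε', β₅', hfg, hgh, hfh, hfσ, hgσ, hhσ, hε', HR'⟩ := hR3
  obtain ⟨b₅, hb₅⟩ := q2_floor_of_reference G r a ha₀ ha hC₁ hC₂ hσ hκ hℓ hρ ηr hE1 hE2 v ε β₅ hvσ HR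
  obtain ⟨b₅', hb₅'⟩ :=
    q3_floor_of_reference G r a ha₀ ha hC₁ hC₂ hC₃ hσ hκ hℓ hρ ηr hE1 hE2 hE3 f g h ε' β₅' hfσ hgσ hhσ HR'
  exact ⟨⟨v, ε, b₅, σ + κ + 1, hasCompactSupport_of_tsupport_subset_closedBall hvσ, hvpos, hε, hb₅⟩,
    ⟨f, g, h, ε', b₅', σ + κ + 1, hasCompactSupport_of_tsupport_subset_closedBall hfσ,
      hasCompactSupport_of_tsupport_subset_closedBall hgσ, hasCompactSupport_of_tsupport_subset_closedBall hhσ,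
      hfg, hgh, hfh, hε', hb₅'⟩⟩

end Kernel

/-- **N from the kernel reference package** — the hypothesis of the landed `Reference.nt_of_referencePackage`
VERBATIM (for every compact simple `G` one `(r, a)` with the constants, reference exteriors, E1/E2/E3-osc and the
two reference floors with margin) ⇒ the leaf's registered stub N `OnsetFloorsK` (witnesses = the package's own,
compactly supported since `tsupport ⊆ closedBall 0 σ`).  Conditional reduction. [folklore] -/
theorem onsetFloorsK_of_referencePackage
    (h : ∀ (G : Type) [Group G] [TopologicalSpace G] [IsTopologicalGroup G] [CompactSpace G],
      IsCompactSimpleLieGroup G → letI : MeasurableSpace G := borel G; haveI : BorelSpace G := ⟨rfl⟩;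
      ∃ (r : LatticeRep G) (a : ℝ → ℝ), (∀ β, 0 < a β) ∧ Tendsto a atTop (𝓝 0) ∧
      ∃ (C₁ C₂ C₃ ℓ ρ σ κ : ℝ) (ηr : ℝ → LGConfig 4 G), 0 ≤ C₁ ∧ 0 ≤ C₂ ∧ 0 ≤ C₃ ∧ 0 < σ ∧ 0 < κ ∧
        2 * (σ + κ) < ℓ ∧ σ + κ < ρ ∧
      (∃ β₁ : ℝ, ∀ β : ℝ, β₁ ≤ β → ∀ (c : Fin 4 → ℤ) (b : ℕ), (b : ℝ) * a β ≤ ℓ →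
        ∀ (η η' : LGConfig 4 G) (x : Fin 4 → ℤ), 1 ≤ depth c b x →
          |kerE G r β c b η (dens G r x) - kerE G r β c b η' (dens G r x)| ≤ C₁ / (depth c b x : ℝ) ^ 4) ∧
      (∃ β₂ : ℝ, ∀ β : ℝ, β₂ ≤ β → ∀ (c : Fin 4 → ℤ) (b : ℕ), (b : ℝ) * a β ≤ ℓ →
        ∀ (η η' : LGConfig 4 G) (x y : Fin 4 → ℤ), 1 ≤ depth c b x → 1 ≤ depth c b y →
          |kerCov G r β c b η (dens G r x) (dens G r y) - kerCov G r β c b η' (dens G r x) (dens G r y)| ≤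
            C₂ / ((min (depth c b x) (depth c b y) : ℕ) : ℝ) ^ 4 / (1 + ‖siteToE (y - x)‖) ^ 4) ∧
      (∃ β₃ : ℝ, ∀ β : ℝ, β₃ ≤ β → ∀ (c : Fin 4 → ℤ) (b : ℕ), (b : ℝ) * a β ≤ ℓ →
        ∀ (η η' : LGConfig 4 G) (x y z : Fin 4 → ℤ), 1 ≤ depth c b x → 1 ≤ depth c b y → 1 ≤ depth c b z →
          |kerK3 G r β c b η x y z - kerK3 G r β c b η' x y z| ≤
            C₃ / ((min (min (depth c b x) (depth c b y)) (depth c b z) : ℕ) : ℝ) ^ 4 /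
              (1 + min (min ‖siteToE (y - x)‖ ‖siteToE (z - y)‖) ‖siteToE (z - x)‖) ^ 8) ∧
      (∃ (v : 𝓢(EuclideanSpace ℝ (Fin 4), ℝ)) (ε β₅ : ℝ),
        tsupport (v : EuclideanSpace ℝ (Fin 4) → ℝ) ⊆ {y | 0 < y 0} ∧
        tsupport (v : EuclideanSpace ℝ (Fin 4) → ℝ) ⊆ Metric.closedBall 0 σ ∧ 0 < ε ∧
        ∀ β : ℝ, β₅ ≤ β →
          ε + 2 * (C₁ * (a β / κ) ^ 4 * ∑ x ∈ box 4 ⌈ρ / a β⌉₊, |thetaTest 4 v (a β • siteToE x)|) *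
                (C₁ * (a β / κ) ^ 4 * ∑ y ∈ box 4 ⌈ρ / a β⌉₊, |v (a β • siteToE y)|) +
              C₂ * (a β / κ) ^ 4 * ∑ x ∈ box 4 ⌈ρ / a β⌉₊, ∑ y ∈ box 4 ⌈ρ / a β⌉₊,
                |thetaTest 4 v (a β • siteToE x)| * |v (a β • siteToE y)| / (1 + ‖siteToE (y - x)‖) ^ 4 ≤
            ∑ x ∈ box 4 ⌈ρ / a β⌉₊, ∑ y ∈ box 4 ⌈ρ / a β⌉₊,
              thetaTest 4 v (a β • siteToE x) * v (a β • siteToE y) *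
                kerCov G r β (fun _ => -(⌈ρ / a β⌉₊ : ℤ)) (2 * ⌈ρ / a β⌉₊ + 1) (ηr β) (dens G r x) (dens G r y)) ∧
      (∃ (f g h : 𝓢(EuclideanSpace ℝ (Fin 4), ℝ)) (ε β₅ : ℝ),
        Disjoint (tsupport (f : EuclideanSpace ℝ (Fin 4) → ℝ)) (tsupport (g : EuclideanSpace ℝ (Fin 4) → ℝ)) ∧
        Disjoint (tsupport (g : EuclideanSpace ℝ (Fin 4) → ℝ)) (tsupport (h : EuclideanSpace ℝ (Fin 4) → ℝ)) ∧
        Disjoint (tsupport (f : EuclideanSpace ℝ (Fin 4) → ℝ)) (tsupport (h : EuclideanSpace ℝ (Fin 4) → ℝ)) ∧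
        tsupport (f : EuclideanSpace ℝ (Fin 4) → ℝ) ⊆ Metric.closedBall 0 σ ∧
        tsupport (g : EuclideanSpace ℝ (Fin 4) → ℝ) ⊆ Metric.closedBall 0 σ ∧
        tsupport (h : EuclideanSpace ℝ (Fin 4) → ℝ) ⊆ Metric.closedBall 0 σ ∧ 0 < ε ∧
        ∀ β : ℝ, β₅ ≤ β →
          ε + ∑ x ∈ box 4 ⌈ρ / a β⌉₊, ∑ y ∈ box 4 ⌈ρ / a β⌉₊, ∑ z ∈ box 4 ⌈ρ / a β⌉₊,
              |f (a β • siteToE x)| * |g (a β • siteToE y)| * |h (a β • siteToE z)| *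
                (2 * ((C₁ * (a β / κ) ^ 4) * (C₂ * (a β / κ) ^ 4 / (1 + ‖siteToE (z - y)‖) ^ 4) +
                      (C₁ * (a β / κ) ^ 4) * (C₂ * (a β / κ) ^ 4 / (1 + ‖siteToE (z - x)‖) ^ 4) +
                      (C₁ * (a β / κ) ^ 4) * (C₂ * (a β / κ) ^ 4 / (1 + ‖siteToE (y - x)‖) ^ 4) +
                      (C₁ * (a β / κ) ^ 4) * (C₁ * (a β / κ) ^ 4) * (C₁ * (a β / κ) ^ 4)) +
                  C₃ * (a β / κ) ^ 4 /
                    (1 + min (min ‖siteToE (y - x)‖ ‖siteToE (z - y)‖) ‖siteToE (z - x)‖) ^ 8) ≤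
            |∑ x ∈ box 4 ⌈ρ / a β⌉₊, ∑ y ∈ box 4 ⌈ρ / a β⌉₊, ∑ z ∈ box 4 ⌈ρ / a β⌉₊,
              f (a β • siteToE x) * g (a β • siteToE y) * h (a β • siteToE z) *
                kerK3 G r β (fun _ => -(⌈ρ / a β⌉₊ : ℤ)) (2 * ⌈ρ / a β⌉₊ + 1) (ηr β) x y z|)) :
    OnsetFloorsK := by
  refine onsetFloorsK_of_lowerBoundsK fun G _ _ _ _ hG _ => ?_
  letI : MeasurableSpace G := borel G
  haveI : BorelSpace G := ⟨rfl⟩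
  obtain ⟨r, a, ha₀, ha, C₁, C₂, C₃, ℓ, ρ, σ, κ, ηr, hC₁, hC₂, hC₃, hσ, hκ, hℓ, hρ, hE1, hE2, hE3, hR2, hR3⟩ :=
    h G hG
  exact ⟨r, a, ha₀, ha,
    lowerBoundsK_of_referencePackage G r a ha₀ ha hC₁ hC₂ hC₃ hσ hκ hℓ hρ ηr hE1 hE2 hE3 hR2 hR3⟩

end Summit.QuantumFields.YangMills.Cruxes.HypercubicOSDataFromInfiniteVolume.OnsetFloorsN

end
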